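import Mathlib
import HarnessLib
import Literature.Analysis.FluidPDE.VectorCalculus
import Literature.Analysis.FluidPDE.ClassicalSolutionCalculus
import Literature.Analysis.FluidPDE.SpaceTimeMixedPartials
import Literature.Analysis.FluidPDE.VorticityEquation
import Literature.Analysis.FluidPDE.VanishingVerticalVorticityPotentials
import Literature.Analysis.FluidPDE.VanishingVerticalVorticityPotentialsTime
import Literature.Analysis.FunctionSpaces.SmoothParametricIntegral
import Summits.NavierStokesRegularity.NavierStokesRegularity.Theorems.LocalSineTubeDoorProfileAlignedWindowRigidityAncient
import Summits.NavierStokesRegularity.NavierStokesRegularity.Theorems.PoloidalWindowDoorPoloidalWindowRigidityClebschVorticity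

/-!
# Route `PoloidalWindowDoor` (staged, nsreg-p1), crux `PoloidalWindowRigidity` (K2) — Clebsch dynamics:
# `curl ∂ₜv = ∇(∂ₜψ) × e₂` and the literal form of (E2), `∇_h T = ∂₂ψ ∇_h v₂ − ∂₂v₂ ∇_h ψ`

Cell ns-regularity-ideate, seat p7 (lead on K2; route-directed support for the open stub `stub_nonflatLiouville`,
to be landed `--supports <PoloidalWindowRigidity item>` once the route is born); fourth Clebsch file
(`…Clebsch`, `…ClebschVorticity`, `…ClebschBernoulli`). For a profile of the route's Type-I class that is
poloidal along `e₂`, with the TIME-DEPENDENT horizontal line potential `φ t` of the slice `v t` and stream function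
`ψ t = (v t)₂ − ∂₂(φ t)` (both jointly smooth on the slab):

* `deriv_linePotential` (generic) — the time derivative commutes with the line potential: `∂ₜφ(t,·)` is the line
  potential of `∂ₜv(t,·)` (reparametrise `t = −e^τ`, differentiate under the integral sign in `τ`, chain rule);
* `deriv_stream` — hence `∂ₜψ(t,·)` is the stream function of the field `∂ₜv(t,·)` (mixed partials
  `∂ₜ∂₂φ = ∂₂∂ₜφ`, tree `IsSmoothSpaceTimeOn.timeDerivWithin_fderiv_slice_apply_of_uniqueDiffOn`), and since
  `(curl ∂ₜv)₂ = ∂ₜ(curl v)₂ = 0` (tree `IsSmoothSpaceTimeOn.curl_timeDerivWithin`):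
  `curl_timeDeriv_apply` — **`(curl ∂ₜv)₀ = ∂₁(∂ₜψ)`, `(curl ∂ₜv)₁ = −∂₀(∂ₜψ)`**;
* `clebsch_T_equation` — combined with `…ClebschVorticity.clebsch_vorticity_equation`: with
  **`T := ∂ₜψ + (v·∇)ψ − Δψ`**, `∂₁T = ∂₂ψ ∂₁v₂ − ∂₂v₂ ∂₁ψ` and `∂₀T = ∂₂ψ ∂₀v₂ − ∂₂v₂ ∂₀ψ` — nsreg-p1's (E2)
  `∇_h T = ∂₃ψ ∇_h v₃ − ∂₃v₃ ∇_h ψ` (R9-PREP §(1)) VERBATIM up to the coordinate labels, kernel-checked.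

WHAT THIS IS NOT: not a claim about Navier–Stokes regularity and not a proof of K2 — kernel bookkeeping for a
STAGED door route's open stub (bears_on LADDER-NS N0, rung N0-LocalTubeDoorPoloidal).
-/

noncomputable section

-- the summit and its single sub-problem share the name (CONVENTIONS §1), as in every Theorems file
set_option linter.dupNamespace false

namespace Summit.NavierStokesRegularity.NavierStokesRegularity.Theorems.PoloidalWindowDoorPoloidalWindowRigidityClebschDynamics

open Set Function MeasureTheory intervalIntegral Filter Topology
open scoped RealInnerProductSpace InnerProductSpace ContDiff Laplacian
open Literature.Analysis Literature.Analysis.FluidPDE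
open Literature.Analysis.FluidPDE.VerticalVorticityFree
open Summit.NavierStokesRegularity.NavierStokesRegularity.Theorems.LocalSineTubeDoorProfileAlignedWindowRigidityAncient
open Summit.NavierStokesRegularity.NavierStokesRegularity.Theorems.PoloidalWindowDoorPoloidalWindowRigidityClebschVorticity

/-! ### Generic: `∂ₜ` commutes with the line potential -/

/-- **The time derivative commutes with the horizontal line potential.** For `v` jointly smooth on the open slab
`(−∞,0) × ℝ³`, `t < 0` and `x`, the derivative in `t` of `∫₀¹ ⟪v t (σ x_h + x₂ e₂), x_h⟫ dσ` is the line
potential of the time derivative `∂ₜv(t, ·)` at `x` (reparametrise `t = −e^τ`, differentiate under the integral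
sign in `τ`, chain rule back). -/
theorem deriv_linePotential
    {v : ℝ → EuclideanSpace ℝ (Fin 3) → EuclideanSpace ℝ (Fin 3)}
    (hv : ContDiffOn ℝ ∞ (uncurry v) (Iio (0 : ℝ) ×ˢ univ)) {t : ℝ} (ht : t < 0)
    (x : EuclideanSpace ℝ (Fin 3)) :
    deriv (fun s : ℝ => ∫ σ in (0 : ℝ)..1, ⟪v s (σ • (x - x 2 • (EuclideanSpace.single (2 : Fin 3) (1 : ℝ))) +
        x 2 • (EuclideanSpace.single (2 : Fin 3) (1 : ℝ))), x - x 2 • (EuclideanSpace.single (2 : Fin 3) (1 : ℝ))⟫_ℝ) t =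
      ∫ σ in (0 : ℝ)..1, ⟪deriv (fun s : ℝ => v s (σ • (x - x 2 • (EuclideanSpace.single (2 : Fin 3) (1 : ℝ))) +
        x 2 • (EuclideanSpace.single (2 : Fin 3) (1 : ℝ)))) t, x - x 2 • (EuclideanSpace.single (2 : Fin 3) (1 : ℝ))⟫_ℝ := by
  set xh : EuclideanSpace ℝ (Fin 3) := x - x 2 • (EuclideanSpace.single (2 : Fin 3) (1 : ℝ)) with hxh
  set c : EuclideanSpace ℝ (Fin 3) := x 2 • (EuclideanSpace.single (2 : Fin 3) (1 : ℝ)) with hc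
  -- globally smooth reparametrised field `w (τ, y) = v (−e^τ) y`
  have hg : ContDiff ℝ ∞ fun q : ℝ × EuclideanSpace ℝ (Fin 3) => ((-Real.exp q.1, q.2) : ℝ × EuclideanSpace ℝ (Fin 3)) :=
    (Real.contDiff_exp.comp contDiff_fst).neg.prodMk contDiff_snd
  have hgmem : ∀ q : ℝ × EuclideanSpace ℝ (Fin 3), ((-Real.exp q.1, q.2) : ℝ × EuclideanSpace ℝ (Fin 3)) ∈
      Iio (0 : ℝ) ×ˢ (univ : Set (EuclideanSpace ℝ (Fin 3))) :=
    fun q => mk_mem_prod (by simpa using Real.exp_pos q.1) (mem_univ _)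
  have hw : ContDiff ℝ ∞ fun q : ℝ × EuclideanSpace ℝ (Fin 3) => v (-Real.exp q.1) q.2 := hv.comp_contDiff hg hgmem
  -- the integrand `H (σ, τ) = ⟪v (−e^τ) (σ xh + c), xh⟫`, smooth on `ℝ × ℝ`
  set H : ℝ × ℝ → ℝ := fun q => ⟪v (-Real.exp q.2) (q.1 • xh + c), xh⟫_ℝ with hH
  have hHs : ContDiff ℝ ∞ H := by
    have h1 : ContDiff ℝ ∞ fun q : ℝ × ℝ => v (-Real.exp q.2) (q.1 • xh + c) :=
      hw.comp (contDiff_snd.prodMk ((contDiff_fst.smul contDiff_const).add contDiff_const))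
    exact h1.inner ℝ contDiff_const
  have hinf : (∞ : WithTop ℕ∞) ≠ 0 := by exact_mod_cast WithTop.coe_ne_zero.2 (by decide)
  -- Ψ τ := ∫ H(σ, τ) dσ has derivative ∫ ∂_τ H
  have hΨ : ∀ τ : ℝ, HasDerivAt (fun τ : ℝ => ∫ σ in (0 : ℝ)..1, H (σ, τ))
      (∫ σ in (0 : ℝ)..1, fderiv ℝ H (σ, τ) ((0 : ℝ), (1 : ℝ))) τ := by
    intro τ
    have hF := Literature.Analysis.FunctionSpaces.hasFDerivAt_parametric_intervalIntegral hHs hinf 0 1 τ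
    have hD := hF.hasDerivAt
    have happ : (∫ σ in (0 : ℝ)..1, (fderiv ℝ H (σ, τ)).comp (ContinuousLinearMap.inr ℝ ℝ ℝ)) (1 : ℝ) =
        ∫ σ in (0 : ℝ)..1, fderiv ℝ H (σ, τ) ((0 : ℝ), (1 : ℝ)) := by
      rw [← Literature.Analysis.FunctionSpaces.fderiv_parametric_intervalIntegral_apply hHs hinf 0 1 τ 1, hF.fderiv]
    rw [happ] at hD
    exact hD
  -- the slice derivative of `H` in `τ`
  have hslice : ∀ σ τ : ℝ, fderiv ℝ H (σ, τ) ((0 : ℝ), (1 : ℝ)) =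
      ⟪(-Real.exp τ) • deriv (fun s : ℝ => v s (σ • xh + c)) (-Real.exp τ), xh⟫_ℝ := by
    intro σ τ
    -- `fderiv H (σ,τ) (0,1) = deriv (fun τ => H (σ,τ)) τ`
    have h1 : fderiv ℝ H (σ, τ) ((0 : ℝ), (1 : ℝ)) = deriv (fun τ' : ℝ => H (σ, τ')) τ := by
      have hc := (Literature.Analysis.FunctionSpaces.hasFDerivAt_comp_prodMk hHs hinf σ τ).hasDerivAt.deriv
      rw [hc, ContinuousLinearMap.comp_apply, ContinuousLinearMap.inr_apply]
    rw [h1]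
    -- differentiate `τ ↦ ⟪v (−e^τ) y, xh⟫`
    have hy : σ • xh + c ∈ (univ : Set (EuclideanSpace ℝ (Fin 3))) := mem_univ _
    have hvd : ∀ s < (0 : ℝ), DifferentiableAt ℝ (fun s' : ℝ => v s' (σ • xh + c)) s := by
      intro s hs
      have hpt : ContDiffAt ℝ ∞ (uncurry v) (s, σ • xh + c) :=
        hv.contDiffAt ((isOpen_Iio.prod isOpen_univ).mem_nhds (mk_mem_prod hs hy))
      have hcomp : ContDiffAt ℝ ∞ (fun s' : ℝ => uncurry v (s', σ • xh + c)) s :=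
        hpt.comp s (contDiffAt_id.prodMk contDiffAt_const)
      exact hcomp.differentiableAt (by simp)
    have hexp : HasDerivAt (fun τ' : ℝ => -Real.exp τ') (-Real.exp τ) τ := (Real.hasDerivAt_exp τ).neg
    have hneg : -Real.exp τ < 0 := by simpa using Real.exp_pos τ
    have hchain : HasDerivAt (fun τ' : ℝ => v (-Real.exp τ') (σ • xh + c))
        ((-Real.exp τ) • deriv (fun s : ℝ => v s (σ • xh + c)) (-Real.exp τ)) τ := by
      have := ((hvd _ hneg).hasDerivAt).scomp τ hexp
      simpa [Function.comp_def] using this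
    have hinner : HasDerivAt (fun τ' : ℝ => H (σ, τ'))
        ⟪(-Real.exp τ) • deriv (fun s : ℝ => v s (σ • xh + c)) (-Real.exp τ), xh⟫_ℝ τ := by
      have := hchain.inner ℝ (hasDerivAt_const τ xh)
      simpa [hH] using this
    exact hinner.deriv
  -- chain rule back: Φ s = Ψ (log (−s)) for s < 0
  have hΦeq : (fun s : ℝ => ∫ σ in (0 : ℝ)..1, ⟪v s (σ • xh + c), xh⟫_ℝ) =ᶠ[nhds t]
      fun s : ℝ => ∫ σ in (0 : ℝ)..1, H (σ, Real.log (-s)) := by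
    filter_upwards [isOpen_Iio.mem_nhds ht] with s hs
    have hs' : (0 : ℝ) < -s := neg_pos.2 hs
    simp only [hH, Real.exp_log hs', neg_neg]
  rw [hΦeq.deriv_eq]
  have hlog : HasDerivAt (fun s : ℝ => Real.log (-s)) (t⁻¹) t := by
    have h := (Real.hasDerivAt_log (neg_ne_zero.2 ht.ne)).comp t (hasDerivAt_neg t)
    have e : (-t)⁻¹ * (-1 : ℝ) = t⁻¹ := by rw [inv_neg]; ring
    simpa [Function.comp_def, e] using h
  have hcomp := (hΨ (Real.log (-t))).comp t hlog
  rw [show (fun s : ℝ => ∫ σ in (0 : ℝ)..1, H (σ, Real.log (-s))) =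
      ((fun τ : ℝ => ∫ σ in (0 : ℝ)..1, H (σ, τ)) ∘ fun s : ℝ => Real.log (-s)) from rfl, hcomp.deriv]
  have ht' : (0 : ℝ) < -t := neg_pos.2 ht
  simp only [hslice, Real.exp_log ht', neg_neg]
  -- `(∫ ⟪t • ∂ₜv, xh⟫) * t⁻¹ = ∫ ⟪∂ₜv, xh⟫`
  simp_rw [real_inner_smul_left]
  rw [intervalIntegral.integral_const_mul, mul_comm, ← mul_assoc, inv_mul_cancel₀ ht.ne, one_mul]


/-! ### The class: `curl ∂ₜv = ∇(∂ₜψ) × e₂` and the literal (E2) -/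

section Profile

variable {C : ℝ} {v : ℝ → EuclideanSpace ℝ (Fin 3) → EuclideanSpace ℝ (Fin 3)}

/-- For a jointly smooth field on the open slab, the within-slab time derivative at `t < 0` is the two-sided
derivative. -/
theorem timeDerivWithin_Iio_eq (v : ℝ → EuclideanSpace ℝ (Fin 3) → EuclideanSpace ℝ (Fin 3)) {t : ℝ} (ht : t < 0) :
    timeDerivWithin (Iio (0 : ℝ)) v t = fun y => deriv (fun s => v s y) t := by
  funext y
  rw [timeDerivWithin_apply, derivWithin_of_isOpen isOpen_Iio ht]

/-- **`∂ₜψ` is the stream function of `∂ₜv`.** With `φ t` the horizontal line potential of `v t` and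
`ψ t y = (v t y)₂ − ∂₂(φ t)(y)`: for `t < 0`,
`∂ₜψ(t, y) = (∂ₜv(t, y))₂ − ∂₂[line potential of ∂ₜv(t,·)](y)`. -/
theorem deriv_stream (hsm : ContDiffOn ℝ ∞ (uncurry v) (Iio (0 : ℝ) ×ˢ univ))
    {φ ψ : ℝ → EuclideanSpace ℝ (Fin 3) → ℝ}
    (hφ : φ = fun (t : ℝ) (x : EuclideanSpace ℝ (Fin 3)) =>
      ∫ σ in (0 : ℝ)..1, ⟪v t (σ • (x - x 2 • (EuclideanSpace.single (2 : Fin 3) (1 : ℝ))) +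
        x 2 • (EuclideanSpace.single (2 : Fin 3) (1 : ℝ))), x - x 2 • (EuclideanSpace.single (2 : Fin 3) (1 : ℝ))⟫_ℝ)
    (hψ : ψ = fun t y => v t y 2 - fderiv ℝ (φ t) y (EuclideanSpace.single 2 1))
    {t : ℝ} (ht : t < 0) (y : EuclideanSpace ℝ (Fin 3)) :
    deriv (fun s => ψ s y) t =
      (deriv (fun s => v s y) t) 2 -
        fderiv ℝ (fun x : EuclideanSpace ℝ (Fin 3) => ∫ σ in (0 : ℝ)..1,
          ⟪(fun z => deriv (fun s => v s z) t) (σ • (x - x 2 • (EuclideanSpace.single (2 : Fin 3) (1 : ℝ))) +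
            x 2 • (EuclideanSpace.single (2 : Fin 3) (1 : ℝ))), x - x 2 • (EuclideanSpace.single (2 : Fin 3) (1 : ℝ))⟫_ℝ)
          y (EuclideanSpace.single 2 1) := by
  have hS : UniqueDiffOn ℝ (Iio (0 : ℝ)) := isOpen_Iio.uniqueDiffOn
  have hφs : IsSmoothSpaceTimeOn (Iio (0 : ℝ)) φ := by
    rw [hφ]; exact contDiffOn_linePotential_uncurry hsm
  -- the two summands of `ψ` are differentiable in time
  have hd1 : DifferentiableAt ℝ (fun s => v s y 2) t := by
    have h := (IsSmoothSpaceTimeOn.differentiableWithinAt_time (w := v) hsm ht y).differentiableAt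
      (isOpen_Iio.mem_nhds ht)
    exact (EuclideanSpace.proj (2 : Fin 3) : EuclideanSpace ℝ (Fin 3) →L[ℝ] ℝ).differentiableAt.comp t h
  have hd2 : DifferentiableAt ℝ (fun s => fderiv ℝ (φ s) y (EuclideanSpace.single 2 1)) t :=
    ((hφs.fderiv_slice hS).differentiableWithinAt_time ht y |>.differentiableAt
      (isOpen_Iio.mem_nhds ht)).clm_apply (differentiableAt_const _)
  have e0 : deriv (fun s => ψ s y) t =
      deriv (fun s => v s y 2) t - deriv (fun s => fderiv ℝ (φ s) y (EuclideanSpace.single 2 1)) t := by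
    rw [hψ]; exact deriv_fun_sub hd1 hd2
  -- coordinate of the time derivative
  have e1 : deriv (fun s => v s y 2) t = (deriv (fun s => v s y) t) 2 := by
    have h := (IsSmoothSpaceTimeOn.differentiableWithinAt_time (w := v) hsm ht y).differentiableAt
      (isOpen_Iio.mem_nhds ht)
    have := ((EuclideanSpace.proj (2 : Fin 3) : EuclideanSpace ℝ (Fin 3) →L[ℝ] ℝ).hasFDerivAt.comp_hasDerivAt t
      h.hasDerivAt).deriv
    exact this
  -- mixed partials: `∂ₜ ∂₂ φ = ∂₂ ∂ₜ φ`
  have e2 : deriv (fun s => fderiv ℝ (φ s) y (EuclideanSpace.single 2 1)) t =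
      fderiv ℝ (timeDerivWithin (Iio (0 : ℝ)) φ t) y (EuclideanSpace.single 2 1) := by
    have h := hφs.timeDerivWithin_fderiv_slice_apply_of_uniqueDiffOn hS ht y (EuclideanSpace.single 2 1)
    rw [timeDerivWithin_apply, derivWithin_of_isOpen isOpen_Iio ht] at h
    exact h
  -- `∂ₜ φ(t, ·)` is the line potential of `∂ₜ v(t, ·)`
  have e3 : timeDerivWithin (Iio (0 : ℝ)) φ t = fun x : EuclideanSpace ℝ (Fin 3) => ∫ σ in (0 : ℝ)..1,
      ⟪(fun z => deriv (fun s => v s z) t) (σ • (x - x 2 • (EuclideanSpace.single (2 : Fin 3) (1 : ℝ))) +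
        x 2 • (EuclideanSpace.single (2 : Fin 3) (1 : ℝ))), x - x 2 • (EuclideanSpace.single (2 : Fin 3) (1 : ℝ))⟫_ℝ := by
    funext x
    rw [timeDerivWithin_apply, derivWithin_of_isOpen isOpen_Iio ht, hφ]
    exact deriv_linePotential hsm ht x
  rw [e0, e1, e2, e3]

/-- **`curl ∂ₜv = ∇(∂ₜψ) × e₂`** for a poloidal profile of the class: `(curl ∂ₜv)₀ = ∂₁(∂ₜψ)`,
`(curl ∂ₜv)₁ = −∂₀(∂ₜψ)` (`∂ₜ` two-sided; `(curl ∂ₜv)₂ = ∂ₜ(curl v)₂ = 0` by the tree's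
`IsSmoothSpaceTimeOn.curl_timeDerivWithin`, then `VerticalVorticityFree.curl_apply_eq_fderiv_stream` for the smooth
field `∂ₜv(t,·)`, whose stream function is `∂ₜψ` by `deriv_stream`). -/
theorem curl_timeDeriv_apply (hrate : HasTypeITimeDecay C v)
    (hcont : ContinuousOn (uncurry v) (Iio (0 : ℝ) ×ˢ univ))
    (hmild : ∀ s t : ℝ, s < t → t < 0 → ∀ x,
      v t x = UnboundedOperators.heatExtension (v s) (t - s) x - oseenDuhamel 1 s v v t x)
    (hpol : ∀ s < 0, ∀ y, ⟪curl (v s) y, EuclideanSpace.single 2 1⟫_ℝ = 0)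
    {φ ψ : ℝ → EuclideanSpace ℝ (Fin 3) → ℝ}
    (hφ : φ = fun (t : ℝ) (x : EuclideanSpace ℝ (Fin 3)) =>
      ∫ σ in (0 : ℝ)..1, ⟪v t (σ • (x - x 2 • (EuclideanSpace.single (2 : Fin 3) (1 : ℝ))) +
        x 2 • (EuclideanSpace.single (2 : Fin 3) (1 : ℝ))), x - x 2 • (EuclideanSpace.single (2 : Fin 3) (1 : ℝ))⟫_ℝ)
    (hψ : ψ = fun t y => v t y 2 - fderiv ℝ (φ t) y (EuclideanSpace.single 2 1))
    {t : ℝ} (ht : t < 0) (y : EuclideanSpace ℝ (Fin 3)) :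
    curl (fun z => deriv (fun s => v s z) t) y 0 = fderiv ℝ (fun z => deriv (fun s => ψ s z) t) y (EuclideanSpace.single 1 1) ∧
    curl (fun z => deriv (fun s => v s z) t) y 1 = -fderiv ℝ (fun z => deriv (fun s => ψ s z) t) y (EuclideanSpace.single 0 1) := by
  have hsm : ContDiffOn ℝ ∞ (uncurry v) (Iio (0 : ℝ) ×ˢ univ) :=
    (analyticOnNhd_uncurry hcont (bdd_of_hasTypeITimeDecay hrate) hmild).contDiffOn_of_completeSpace
  have hS : UniqueDiffOn ℝ (Iio (0 : ℝ)) := isOpen_Iio.uniqueDiffOn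
  -- the time derivative as a slice of a jointly smooth field
  set V' : EuclideanSpace ℝ (Fin 3) → EuclideanSpace ℝ (Fin 3) := fun z => deriv (fun s => v s z) t with hV'
  have hTD : timeDerivWithin (Iio (0 : ℝ)) v t = V' := timeDerivWithin_Iio_eq v ht
  have hV's : ContDiff ℝ ∞ V' := by
    rw [← hTD]; exact (IsSmoothSpaceTimeOn.timeDerivWithin hsm hS).contDiff_slice ht
  -- `(curl ∂ₜv)₂ = ∂ₜ (curl v)₂ = 0`
  have hc2 : ∀ z, curl V' z 2 = 0 := by
    intro z
    have hcl : (Iio (0 : ℝ)) ⊆ closure (interior (Iio (0 : ℝ))) := by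
      rw [isOpen_Iio.interior_eq]; exact subset_closure
    have h := IsSmoothSpaceTimeOn.curl_timeDerivWithin hsm hS hcl ht z
    rw [hTD] at h
    rw [h, timeDerivWithin_apply, derivWithin_of_isOpen isOpen_Iio ht]
    -- the vertical vorticity vanishes identically in time
    have hzero : (fun s => vorticity v s z 2) =ᶠ[nhds t] fun _ => (0 : ℝ) := by
      filter_upwards [isOpen_Iio.mem_nhds ht] with s hs
      have h := hpol s hs z
      simp only [EuclideanSpace.inner_single_right, one_mul, conj_trivial] at h
      exact h
    have hvort : IsSmoothSpaceTimeOn (Iio (0 : ℝ)) (vorticity v) := by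
      have h1 := IsSmoothSpaceTimeOn.fderiv_slice hsm hS
      have e : vorticity v = fun s y => curlCLM (fderiv ℝ (v s) y) := by funext s y; rfl
      rw [e]
      exact (curlCLM.contDiff.comp_contDiffOn h1).congr fun q _ => by rcases q with ⟨s, y⟩; rfl
    have hd : DifferentiableAt ℝ (fun s => vorticity v s z) t :=
      (hvort.differentiableWithinAt_time ht z).differentiableAt (isOpen_Iio.mem_nhds ht)
    have e : deriv (fun s => vorticity v s z) t 2 = deriv (fun s => vorticity v s z 2) t := by
      have := ((EuclideanSpace.proj (2 : Fin 3) : EuclideanSpace ℝ (Fin 3) →L[ℝ] ℝ).hasFDerivAt.comp_hasDerivAt t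
        hd.hasDerivAt).deriv
      exact this.symm
    rw [e, hzero.deriv_eq, deriv_const]
  -- the stream function of `V'` is `∂ₜψ`
  have hstream : (fun z => V' z 2 - fderiv ℝ (fun x : EuclideanSpace ℝ (Fin 3) => ∫ σ in (0 : ℝ)..1,
      ⟪V' (σ • (x - x 2 • (EuclideanSpace.single (2 : Fin 3) (1 : ℝ))) + x 2 • (EuclideanSpace.single (2 : Fin 3) (1 : ℝ))),
        x - x 2 • (EuclideanSpace.single (2 : Fin 3) (1 : ℝ))⟫_ℝ) z (EuclideanSpace.single 2 1)) =
      fun z => deriv (fun s => ψ s z) t := by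
    funext z
    rw [deriv_stream hsm hφ hψ ht z]
  obtain ⟨h0, h1, -⟩ := curl_apply_eq_fderiv_stream hV's hc2 rfl y
  rw [hstream] at h0 h1
  exact ⟨h0, h1⟩

/-- **(E2), literal form: `∇_h T = ∂₂ψ ∇_h v₂ − ∂₂v₂ ∇_h ψ` with `T = ∂ₜψ + (v·∇)ψ − Δψ`.** Under EXACTLY the
hypotheses of `stub_nonflatLiouville` (class + poloidality along `e₂`), with the time-dependent horizontal line
potential `φ` and stream function `ψ = v₂ − ∂₂φ`: for every `t < 0` and `y`,
`∂₁T(t,y) = ∂₂ψ ∂₁v₂ − ∂₂v₂ ∂₁ψ` and `∂₀T(t,y) = ∂₂ψ ∂₀v₂ − ∂₂v₂ ∂₀ψ` (nsreg-p1 R9-PREP §(1) (E2), indices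
`(0,1,2)` for the memo's `(1,2,3)`). Proof: `…ClebschVorticity.clebsch_vorticity_equation` (the tree's vorticity
equation in Clebsch variables) + `curl_timeDeriv_apply`. -/
theorem clebsch_T_equation (hrate : HasTypeITimeDecay C v)
    (hcont : ContinuousOn (uncurry v) (Iio (0 : ℝ) ×ˢ univ))
    (hmild : ∀ s t : ℝ, s < t → t < 0 → ∀ x,
      v t x = UnboundedOperators.heatExtension (v s) (t - s) x - oseenDuhamel 1 s v v t x)
    (hdiv : ∀ t < 0, VectorCalculus.IsDivFree (v t))
    (hpol : ∀ s < 0, ∀ y, ⟪curl (v s) y, EuclideanSpace.single 2 1⟫_ℝ = 0)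
    {φ ψ : ℝ → EuclideanSpace ℝ (Fin 3) → ℝ}
    (hφ : φ = fun (t : ℝ) (x : EuclideanSpace ℝ (Fin 3)) =>
      ∫ σ in (0 : ℝ)..1, ⟪v t (σ • (x - x 2 • (EuclideanSpace.single (2 : Fin 3) (1 : ℝ))) +
        x 2 • (EuclideanSpace.single (2 : Fin 3) (1 : ℝ))), x - x 2 • (EuclideanSpace.single (2 : Fin 3) (1 : ℝ))⟫_ℝ)
    (hψ : ψ = fun t y => v t y 2 - fderiv ℝ (φ t) y (EuclideanSpace.single 2 1))
    {t : ℝ} (ht : t < 0) (y : EuclideanSpace ℝ (Fin 3)) :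
    fderiv ℝ (fun z => deriv (fun s => ψ s z) t + (convect (v t) (ψ t) z - (Δ (ψ t)) z)) y
        (EuclideanSpace.single 1 1) =
      fderiv ℝ (ψ t) y (EuclideanSpace.single 2 1) * fderiv ℝ (v t) y (EuclideanSpace.single 1 1) 2 -
        fderiv ℝ (v t) y (EuclideanSpace.single 2 1) 2 * fderiv ℝ (ψ t) y (EuclideanSpace.single 1 1) ∧
    fderiv ℝ (fun z => deriv (fun s => ψ s z) t + (convect (v t) (ψ t) z - (Δ (ψ t)) z)) y
        (EuclideanSpace.single 0 1) =
      fderiv ℝ (ψ t) y (EuclideanSpace.single 2 1) * fderiv ℝ (v t) y (EuclideanSpace.single 0 1) 2 -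
        fderiv ℝ (v t) y (EuclideanSpace.single 2 1) 2 * fderiv ℝ (ψ t) y (EuclideanSpace.single 0 1) := by
  have hsm : ContDiffOn ℝ ∞ (uncurry v) (Iio (0 : ℝ) ×ˢ univ) :=
    (analyticOnNhd_uncurry hcont (bdd_of_hasTypeITimeDecay hrate) hmild).contDiffOn_of_completeSpace
  have hS : UniqueDiffOn ℝ (Iio (0 : ℝ)) := isOpen_Iio.uniqueDiffOn
  have hφs : IsSmoothSpaceTimeOn (Iio (0 : ℝ)) φ := by
    rw [hφ]; exact contDiffOn_linePotential_uncurry hsm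
  have hψs : IsSmoothSpaceTimeOn (Iio (0 : ℝ)) ψ := by
    have h1 : ContDiffOn ℝ ∞ (fun q : ℝ × EuclideanSpace ℝ (Fin 3) => (uncurry v) q 2) (Iio (0 : ℝ) ×ˢ univ) :=
      (EuclideanSpace.proj (2 : Fin 3) : EuclideanSpace ℝ (Fin 3) →L[ℝ] ℝ).contDiff.comp_contDiffOn hsm
    have h2 : ContDiffOn ℝ ∞ (fun q : ℝ × EuclideanSpace ℝ (Fin 3) =>
        (uncurry (fun t x => fderiv ℝ (φ t) x)) q (EuclideanSpace.single 2 1)) (Iio (0 : ℝ) ×ˢ univ) :=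
      ContDiffOn.clm_apply (show ContDiffOn ℝ ∞ (uncurry fun t x => fderiv ℝ (φ t) x)
        (Iio (0 : ℝ) ×ˢ univ) from hφs.fderiv_slice hS) contDiffOn_const
    rw [hψ]
    exact (h1.sub h2).congr fun q _ => by rcases q with ⟨s, z⟩; rfl
  -- slice identities
  have hφt : φ t = fun x : EuclideanSpace ℝ (Fin 3) =>
      ∫ σ in (0 : ℝ)..1, ⟪v t (σ • (x - x 2 • (EuclideanSpace.single (2 : Fin 3) (1 : ℝ))) +
        x 2 • (EuclideanSpace.single (2 : Fin 3) (1 : ℝ))), x - x 2 • (EuclideanSpace.single (2 : Fin 3) (1 : ℝ))⟫_ℝ := by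
    rw [hφ]
  have hψt : ψ t = fun z => v t z 2 - fderiv ℝ (φ t) z (EuclideanSpace.single 2 1) := by rw [hψ]
  obtain ⟨c0, c1⟩ := clebsch_vorticity_equation hrate hcont hmild hdiv hpol ht hφt y
  obtain ⟨d0, d1⟩ := curl_timeDeriv_apply hrate hcont hmild hpol hφ hψ ht y
  rw [← hψt] at c0 c1
  -- differentiability of the two summands of `T`
  have hTd : DifferentiableAt ℝ (fun z => deriv (fun s => ψ s z) t) y := by
    have h := (IsSmoothSpaceTimeOn.timeDerivWithin hψs hS).contDiff_slice ht
    have e : timeDerivWithin (Iio (0 : ℝ)) ψ t = fun z => deriv (fun s => ψ s z) t := by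
      funext z; rw [timeDerivWithin_apply, derivWithin_of_isOpen isOpen_Iio ht]
    rw [e] at h
    exact (h.differentiable (by simp)) y
  have hψsl : ContDiff ℝ ∞ (ψ t) := hψs.contDiff_slice ht
  have hV : ContDiff ℝ ∞ (v t) := IsSmoothSpaceTimeOn.contDiff_slice hsm ht
  have hRd : DifferentiableAt ℝ (fun z => convect (v t) (ψ t) z - (Δ (ψ t)) z) y := by
    have hdc : ContDiff ℝ ∞ fun z => convect (v t) (ψ t) z := (hψsl.fderiv_right (m := ∞) le_rfl).clm_apply hV
    have hdl : ContDiff ℝ (1 : ℕ∞) (Δ (ψ t)) := contDiff_laplacian (n := 1) (hψsl.of_le (by norm_cast))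
    exact ((hdc.differentiable (by simp)) y).sub ((hdl.differentiable (by simp)) y)
  rw [fderiv_fun_add hTd hRd]
  refine ⟨?_, ?_⟩
  · rw [_root_.add_apply, ← d0]; exact c0
  · rw [_root_.add_apply]
    have := c1
    rw [d1] at this
    linarith

end Profile

end Summit.NavierStokesRegularity.NavierStokesRegularity.Theorems.PoloidalWindowDoorPoloidalWindowRigidityClebschDynamics

end
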